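import Summits.QuantumFields.YangMills.Theorems.UnitScaleTiltProp8ActionFirstVariation
import Literature.MathematicalPhysics.QuantumFieldTheory.Balaban1983to89.T3Thm1CarrierNative
import HarnessLib

/-!
# Route `UnitScaleTilt`, crux K1 child «MinimiserStabilityRegPr» (stmt-QuantumFields-19200), registered stub `stub_prop8` (v5 98cb23610ad721f5; leaf V2
# «[Balaban1985Variational] Prop. 8 at the d = 3 carriers» = `B11.Prop8Printed B₃ (T3Thm1Carrier.famX L)` ⟺ `T3Thm1CarrierNative.Prop8NativeAt`) —
# sub-lemma V2-EL, part 2/2: THE CRITICALITY STRUCTURE OF CONSTRAINED MINIMISERS — the EULER–LAGRANGE EQUATION ALONG CURVES in any admissible set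
# (`Lin_{U₀}(ξ) = 0` for every first-order velocity `ξ` of a curve of competitors through a minimiser), and at the d = 3 carrier: an R2-critical
# configuration (`T3Thm1CarrierNative.IsCritR2`) minimises over the ONE-STEP-type slice of its own `(J,K)`-descent for every intermediate height `J`
# (NESTED CRITICALITY — every variational equation of Sects. E–F involves the one-step (0.4)-average only), and its first variation vanishes along
# every curve in the regular fibres

Cell `ym3-torus` ∕ fleet seat `ym-ust-19200-p2` (HUMAN RULING D-0037, YM ladder rung R3), successor g3.  WHERE THIS SITS.  [Balaban1985Variational] p. 300:
«In this section we will prove all the regularity properties of minimal configurations U_k. We will use only the fact that they are critical configurations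
of the functional (5) and that they belong to the spaces (6) with ε₀ sufficiently small.»  At the carrier `T3Thm1Carrier.varProblem3` «critical» is READ (R2)
as «minimises the Wilson action over print's regular fibre (6)(e) for some e > 0» (`IsCritR2`); the variational content print extracts from it — the
vanishing of the first variation (26)–(27) along the constraint manifold 𝔅_k(V) ((127) p. 297 «for all δA′ satisfying QδA′ = 0», stated there AFTER the
chart (47) of Sect. C has straightened the constraint) — is isolated here at the lattice level WITHOUT the chart: §1 is the Fermat argument along any curve
of competitors that is `tξ` to first order bondwise, with the two-sided expansion of part 1 (`Prop8Criticality.abs_wilsonAction4_sub_sub_lin_le`) supplying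
the `O(t²)` control for both signs of `t`; so the Sect. C chart at the carrier (one step: `Prop7AvgLinearisation.exists_fibre_point_near_of_linearised`
p487532, exact corrector `BlockAvgCorrector.exists_avgFun_eq_of_near` p448916) only has to DELIVER the curves.  §2 records that for the k-fold problem the
curves need only be one-step fibre curves over the minimiser's own `(K−1)`-fold average (`T3DescentFibreTower.mem_fibre_trans`: fibres compose along the
tower, [Balaban1987RG1] (0.11)).

WHAT IS PROVED (sorry-free, no definition; our own statements — [folklore] ∕ cited to the printed step they instantiate):
* §1 `norm_coe_sub_one_le_two`, `eq_zero_of_forall_mul_add_sq_nonneg` (scalar endgame), **`lin_eq_zero_of_isMinOn_of_curve`** (Euler–Lagrange along curves: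
  any lattice `T^{(j)}`, any admissible set `S`, minimiser `U₀` of the `SU(2)` Wilson action over `S`, curve `γ(t) ∈ S` with
  `‖γ(t)(b)U₀(b)^* − 1 − tξ(b)‖ ≤ Ct²` ⟹ `Lin_{U₀}(ξ) = 0`);
* §2 (d = 3 carrier) `oneStepSlice_subset_regFibrePr`, `mem_oneStepSlice`, **`isMinOn_oneStepSlice_of_isMinOn`**, **`isCritR2_oneStepSlice`** (nested
  criticality), **`lin_eq_zero_of_isCritR2_of_curve`** (Euler–Lagrange at the carrier for R2-critical configurations along curves in the regular fibres).

References: T. Bałaban, CMP 102 (1985) 277–309 [Balaban1985Variational] ((5)–(6) p.278, (26)–(27) p.282, (127) p.297, p.300, Prop. 8 p.304);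
CMP 109 (1987) 249–301 [Balaban1987RG1] ((0.11) p.253).
-/

noncomputable section

open scoped BigOperators Matrix.Norms.L2Operator Matrix

namespace Summit.QuantumFields.YangMills.Theorems.Prop8Criticality

open Literature.MathematicalPhysics.QuantumFieldTheory.Balaban1983to89
open Finset
open Summit.QuantumFields.YangMills.Theorems.Prop7CovariantCoercivity (sum_norm_sq_add_eq sum_norm_sq_mul_unitary abs_re_trace_le
  sum_norm_sq_le_mul_opNorm_sq wilsonAction4_eq_quarter_sum_hs norm_plaqHol_mul_star_bg_sub_one_sub_lin_le plaqHol_eq_word)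
open Summit.QuantumFields.YangMills.Theorems.Prop7FlatLocalMin (sum_plaq_bonds_le)

/-! ## §1 The Euler–Lagrange equation along curves in the admissible set -/

section EulerLagrange

variable {P : Params} {j : ℕ}

/-- `‖g − 1‖ ≤ 2` for a special unitary `g` (read in `M₂(ℂ)`). [folklore] -/
theorem norm_coe_sub_one_le_two (g : Matrix.specialUnitaryGroup (Fin 2) ℂ) : ‖(g : Matrix (Fin 2) (Fin 2) ℂ) - 1‖ ≤ 2 := by
  have h1 : ‖(g : Matrix (Fin 2) (Fin 2) ℂ)‖ = 1 := UnitaryModel.norm_of_mem_unitaryGroup (Matrix.specialUnitaryGroup_le_unitaryGroup g.2)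
  have h2 : ‖(1 : Matrix (Fin 2) (Fin 2) ℂ)‖ = 1 := norm_one
  calc ‖(g : Matrix (Fin 2) (Fin 2) ℂ) - 1‖ ≤ ‖(g : Matrix (Fin 2) (Fin 2) ℂ)‖ + ‖(1 : Matrix (Fin 2) (Fin 2) ℂ)‖ := norm_sub_le _ _
    _ = 2 := by rw [h1, h2]; norm_num

/-- Scalar endgame of the Fermat argument: if `0 ≤ tℓ + Kt²` for all `|t| ≤ t₁` with `t₁ > 0`, `K ≥ 0`, then `ℓ = 0`. [folklore] -/
theorem eq_zero_of_forall_mul_add_sq_nonneg {ℓ K t₁ : ℝ} (ht₁ : 0 < t₁) (hK : 0 ≤ K) (h : ∀ t : ℝ, |t| ≤ t₁ → 0 ≤ t * ℓ + K * t ^ 2) : ℓ = 0 := by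
  by_contra hℓ
  rcases lt_or_gt_of_ne hℓ with hneg | hpos
  · -- `ℓ < 0`: take `t = min t₁ (−ℓ/(2(K+1))) > 0`
    set τ : ℝ := min t₁ (-ℓ / (2 * (K + 1))) with hτ
    have hK1 : 0 < K + 1 := by linarith
    have hτpos : 0 < τ := lt_min ht₁ (div_pos (by linarith) (by linarith))
    have hτ₁ : τ ≤ t₁ := min_le_left _ _
    have hτ₂ : τ ≤ -ℓ / (2 * (K + 1)) := min_le_right _ _
    have hτ₂' : 2 * (K + 1) * τ ≤ -ℓ := by
      have := mul_le_mul_of_nonneg_left hτ₂ (by linarith : (0 : ℝ) ≤ 2 * (K + 1))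
      rwa [mul_div_cancel₀ _ (by linarith : (2 : ℝ) * (K + 1) ≠ 0)] at this
    have h0 := h τ (by rw [abs_of_pos hτpos]; exact hτ₁)
    -- `0 ≤ τℓ + Kτ² ≤ τℓ + (K+1)τ·τ ≤ τℓ − τℓ/2 < 0`
    have : τ * ℓ + K * τ ^ 2 < 0 := by nlinarith
    linarith
  · set τ : ℝ := min t₁ (ℓ / (2 * (K + 1))) with hτ
    have hK1 : 0 < K + 1 := by linarith
    have hτpos : 0 < τ := lt_min ht₁ (div_pos hpos (by linarith))
    have hτ₁ : τ ≤ t₁ := min_le_left _ _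
    have hτ₂ : τ ≤ ℓ / (2 * (K + 1)) := min_le_right _ _
    have hτ₂' : 2 * (K + 1) * τ ≤ ℓ := by
      have := mul_le_mul_of_nonneg_left hτ₂ (by linarith : (0 : ℝ) ≤ 2 * (K + 1))
      rwa [mul_div_cancel₀ _ (by linarith : (2 : ℝ) * (K + 1) ≠ 0)] at this
    have h0 := h (-τ) (by rw [abs_neg, abs_of_pos hτpos]; exact hτ₁)
    have : (-τ) * ℓ + K * (-τ) ^ 2 < 0 := by nlinarith
    linarith

/-- **THE EULER–LAGRANGE EQUATION ALONG CURVES IN THE ADMISSIBLE SET** (`SU(2)`, any lattice, any admissible set `S`): if `U₀` minimises the Wilson action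
over `S` and `γ(t) ∈ S` (`|t| ≤ t₀`) is a curve whose fluctuation about `U₀` is `tξ` to first order bondwise — `‖γ(t)(b)U₀(b)^* − 1 − tξ(b)‖ ≤ Ct²` —,
then the exact first variation VANISHES in the direction `ξ`: `Lin_{U₀}(ξ) = ½Σ_p Re Tr((U₀(∂p) − 1)^*·L_p(ξ)·U₀(∂p)) = 0`.  This is (127) p. 297
(«for all δA′ satisfying QδA′ = 0») BEFORE the chart: the constraint manifold enters only through the curves it carries; the two-sided expansion
`abs_wilsonAction4_sub_sub_lin_le` supplies the `O(t²)` control and the sign of `t` is free. [cite: Balaban1985Variational, (127) p.297, (26)-(27) p.282] -/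
theorem lin_eq_zero_of_isMinOn_of_curve {S : Set (GaugeField P j (Matrix.specialUnitaryGroup (Fin 2) ℂ))}
    {U₀ : GaugeField P j (Matrix.specialUnitaryGroup (Fin 2) ℂ)}
    (hmin : IsMinOn (fun W : GaugeField P j (Matrix.specialUnitaryGroup (Fin 2) ℂ) => wilsonAction4 W) S U₀)
    (γ : ℝ → GaugeField P j (Matrix.specialUnitaryGroup (Fin 2) ℂ)) {t₀ C₀ : ℝ} (ht₀ : 0 < t₀) (hγS : ∀ t : ℝ, |t| ≤ t₀ → γ t ∈ S)
    (ξ : PBond P j → Matrix (Fin 2) (Fin 2) ℂ)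
    (hγξ₀ : ∀ t : ℝ, |t| ≤ t₀ → ∀ b : PBond P j,
      ‖(γ t b : Matrix (Fin 2) (Fin 2) ℂ) * star (U₀ b : Matrix (Fin 2) (Fin 2) ℂ) - 1 - (t : ℂ) • ξ b‖ ≤ C₀ * t ^ 2) :
    ∑ p : Plaq P j, (1 / 2) * ((((((GaugeField.plaqHol U₀ p : Matrix.specialUnitaryGroup (Fin 2) ℂ) : Matrix (Fin 2) (Fin 2) ℂ)) - 1)ᴴ
          * ((ξ ⟨p.src, p.μ⟩
              + (U₀ ⟨p.src, p.μ⟩ : Matrix (Fin 2) (Fin 2) ℂ) * ξ ⟨p.src.shift p.μ, p.ν⟩ * star (U₀ ⟨p.src, p.μ⟩ : Matrix (Fin 2) (Fin 2) ℂ)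
              - ((U₀ ⟨p.src, p.μ⟩ * U₀ ⟨p.src.shift p.μ, p.ν⟩ * (U₀ ⟨p.src.shift p.ν, p.μ⟩)⁻¹ : Matrix.specialUnitaryGroup (Fin 2) ℂ) : Matrix (Fin 2) (Fin 2) ℂ)
                  * ξ ⟨p.src.shift p.ν, p.μ⟩
                  * star ((U₀ ⟨p.src, p.μ⟩ * U₀ ⟨p.src.shift p.μ, p.ν⟩ * (U₀ ⟨p.src.shift p.ν, p.μ⟩)⁻¹ : Matrix.specialUnitaryGroup (Fin 2) ℂ) : Matrix (Fin 2) (Fin 2) ℂ)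
              - ((GaugeField.plaqHol U₀ p : Matrix.specialUnitaryGroup (Fin 2) ℂ) : Matrix (Fin 2) (Fin 2) ℂ) * ξ ⟨p.src, p.ν⟩
                  * star ((GaugeField.plaqHol U₀ p : Matrix.specialUnitaryGroup (Fin 2) ℂ) : Matrix (Fin 2) (Fin 2) ℂ))
            * ((GaugeField.plaqHol U₀ p : Matrix.specialUnitaryGroup (Fin 2) ℂ) : Matrix (Fin 2) (Fin 2) ℂ))).trace).re = 0 := by
  -- the first variation as a function of the bond field
  set Λ : (PBond P j → Matrix (Fin 2) (Fin 2) ℂ) → ℝ := fun Z =>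
    ∑ p : Plaq P j, (1 / 2) * ((((((GaugeField.plaqHol U₀ p : Matrix.specialUnitaryGroup (Fin 2) ℂ) : Matrix (Fin 2) (Fin 2) ℂ)) - 1)ᴴ
          * ((Z ⟨p.src, p.μ⟩
              + (U₀ ⟨p.src, p.μ⟩ : Matrix (Fin 2) (Fin 2) ℂ) * Z ⟨p.src.shift p.μ, p.ν⟩ * star (U₀ ⟨p.src, p.μ⟩ : Matrix (Fin 2) (Fin 2) ℂ)
              - ((U₀ ⟨p.src, p.μ⟩ * U₀ ⟨p.src.shift p.μ, p.ν⟩ * (U₀ ⟨p.src.shift p.ν, p.μ⟩)⁻¹ : Matrix.specialUnitaryGroup (Fin 2) ℂ) : Matrix (Fin 2) (Fin 2) ℂ)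
                  * Z ⟨p.src.shift p.ν, p.μ⟩
                  * star ((U₀ ⟨p.src, p.μ⟩ * U₀ ⟨p.src.shift p.μ, p.ν⟩ * (U₀ ⟨p.src.shift p.ν, p.μ⟩)⁻¹ : Matrix.specialUnitaryGroup (Fin 2) ℂ) : Matrix (Fin 2) (Fin 2) ℂ)
              - ((GaugeField.plaqHol U₀ p : Matrix.specialUnitaryGroup (Fin 2) ℂ) : Matrix (Fin 2) (Fin 2) ℂ) * Z ⟨p.src, p.ν⟩
                  * star ((GaugeField.plaqHol U₀ p : Matrix.specialUnitaryGroup (Fin 2) ℂ) : Matrix (Fin 2) (Fin 2) ℂ))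
            * ((GaugeField.plaqHol U₀ p : Matrix.specialUnitaryGroup (Fin 2) ℂ) : Matrix (Fin 2) (Fin 2) ℂ))).trace).re with hΛ
  change Λ ξ = 0
  -- the fluctuation of the curve and its defect against `tξ`
  set Y : ℝ → PBond P j → Matrix (Fin 2) (Fin 2) ℂ := fun t b =>
    (γ t b : Matrix (Fin 2) (Fin 2) ℂ) * star (U₀ b : Matrix (Fin 2) (Fin 2) ℂ) - 1 with hY
  -- sizes
  set M : ℝ := ∑ b : PBond P j, ‖ξ b‖ with hM
  set B : ℝ := (Fintype.card (PBond P j) : ℝ) with hB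
  set D : ℝ := (P.d : ℝ) with hD
  have hM0 : 0 ≤ M := Finset.sum_nonneg fun b _ => norm_nonneg _
  have hB0 : 0 ≤ B := Nat.cast_nonneg _
  have hD0 : 0 ≤ D := Nat.cast_nonneg _
  have hMb : ∀ b : PBond P j, ‖ξ b‖ ≤ M := fun b =>
    Finset.single_le_sum (f := fun b => ‖ξ b‖) (fun b _ => norm_nonneg _) (Finset.mem_univ b)
  -- WLOG the defect constant is nonnegative
  set C : ℝ := max C₀ 0 with hC
  have hC0 : 0 ≤ C := le_max_right _ _
  have hγξ : ∀ t : ℝ, |t| ≤ t₀ → ∀ b : PBond P j,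
      ‖(γ t b : Matrix (Fin 2) (Fin 2) ℂ) * star (U₀ b : Matrix (Fin 2) (Fin 2) ℂ) - 1 - (t : ℂ) • ξ b‖ ≤ C * t ^ 2 := fun t ht b =>
    (hγξ₀ t ht b).trans (mul_le_mul_of_nonneg_right (le_max_left _ _) (sq_nonneg t))
  -- (1) linearity: `Λ(Y t) − t·Λ ξ = Λ(Y t − tξ)`, and the `ℓ¹` bound of `Λ`
  have hlin : ∀ t : ℝ, Λ (Y t) - t * Λ ξ = Λ (fun b => Y t b - (t : ℂ) • ξ b) := by
    intro t
    simp only [hΛ, Finset.mul_sum, ← Finset.sum_sub_distrib]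
    exact Finset.sum_congr rfl fun p _ => linPlaq_sub_smul U₀ (Y t) ξ t p
  have hΛle : ∀ W : PBond P j → Matrix (Fin 2) (Fin 2) ℂ, |Λ W| ≤ 2 * (4 * D) * ∑ b : PBond P j, ‖W b‖ := by
    intro W
    simp only [hΛ]
    refine (Finset.abs_sum_le_sum_abs _ _).trans ?_
    have hper : ∀ p : Plaq P j, _ ≤ 2 * (‖W ⟨p.src, p.μ⟩‖ + ‖W ⟨p.src.shift p.μ, p.ν⟩‖ + ‖W ⟨p.src.shift p.ν, p.μ⟩‖ + ‖W ⟨p.src, p.ν⟩‖) :=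
      fun p => (abs_linPlaq_le U₀ W p).trans (mul_le_mul_of_nonneg_right (norm_coe_sub_one_le_two _) (by positivity))
    refine (Finset.sum_le_sum fun p _ => hper p).trans ?_
    rw [← Finset.mul_sum, mul_assoc]
    exact mul_le_mul_of_nonneg_left (sum_plaq_bonds_le (fun b => ‖W b‖) fun b => norm_nonneg _) zero_le_two
  -- (2) the window `|t| ≤ t₁`: fluctuations `≤ |t|(M + C) ≤ 1/4`
  set t₁ : ℝ := min t₀ (min 1 (1 / (4 * (M + C) + 1))) with ht₁
  have ht₁pos : 0 < t₁ := lt_min ht₀ (lt_min one_pos (by positivity))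
  have ht₁₀ : t₁ ≤ t₀ := min_le_left _ _
  have ht₁₁ : t₁ ≤ 1 := (min_le_right _ _).trans (min_le_left _ _)
  have ht₁₂ : t₁ ≤ 1 / (4 * (M + C) + 1) := (min_le_right _ _).trans (min_le_right _ _)
  have hwin : t₁ * (M + C) ≤ 1 / 4 := by
    have h1 : t₁ * (4 * (M + C) + 1) ≤ 1 := by
      have := mul_le_mul_of_nonneg_right ht₁₂ (by positivity : (0 : ℝ) ≤ 4 * (M + C) + 1)
      rwa [div_mul_cancel₀ _ (by positivity : (4 : ℝ) * (M + C) + 1 ≠ 0)] at this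
    nlinarith
  have hYb : ∀ t : ℝ, |t| ≤ t₁ → ∀ b : PBond P j, ‖Y t b‖ ≤ |t| * (M + C) := by
    intro t ht b
    have h1 := hγξ t (ht.trans ht₁₀) b
    have h2 : ‖(t : ℂ) • ξ b‖ = |t| * ‖ξ b‖ := by rw [norm_smul, Complex.norm_real, Real.norm_eq_abs]
    have h3 : ‖Y t b‖ ≤ ‖(t : ℂ) • ξ b‖ + ‖Y t b - (t : ℂ) • ξ b‖ := by
      have := norm_add_le ((t : ℂ) • ξ b) (Y t b - (t : ℂ) • ξ b); rwa [add_sub_cancel] at this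
    have h4 : t ^ 2 ≤ |t| := by
      have : |t| ≤ 1 := ht.trans ht₁₁
      calc t ^ 2 = |t| * |t| := by rw [← sq_abs, sq]
        _ ≤ |t| * 1 := mul_le_mul_of_nonneg_left this (abs_nonneg t)
        _ = |t| := mul_one _
    have h5 := hMb b
    have h6 : ‖Y t b - (t : ℂ) • ξ b‖ ≤ C * t ^ 2 := h1
    nlinarith [abs_nonneg t, norm_nonneg (ξ b)]
  -- (3) for `|t| ≤ t₁`: `0 ≤ tΛξ + Kt²`
  have key : ∀ t : ℝ, |t| ≤ t₁ → 0 ≤ t * Λ ξ + ((8 * 2 + 18) * (4 * D) * (B * (M + C) ^ 2) + 2 * (4 * D) * (B * C)) * t ^ 2 := by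
    intro t ht
    have hδ : ∀ b : PBond P j, ‖(γ t b : Matrix (Fin 2) (Fin 2) ℂ) * star (U₀ b : Matrix (Fin 2) (Fin 2) ℂ) - 1‖ ≤ |t| * (M + C) := hYb t ht
    have hδ4 : |t| * (M + C) ≤ 1 / 4 := (mul_le_mul_of_nonneg_right ht (by linarith)).trans hwin
    -- the two-sided expansion at `U := γ t`
    have h2 := abs_wilsonAction4_sub_sub_lin_le (γ t) U₀ zero_le_two (fun p => norm_coe_sub_one_le_two _) hδ hδ4
    change |wilsonAction4 (γ t) - wilsonAction4 U₀ - Λ (Y t)| ≤ (8 * 2 + 18) * (4 * P.d) * ∑ b : PBond P j, ‖Y t b‖ ^ 2 at h2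
    -- minimality
    have h0 : 0 ≤ wilsonAction4 (γ t) - wilsonAction4 U₀ := sub_nonneg.mpr (hmin (hγS t (ht.trans ht₁₀)))
    -- `Σ‖Y t b‖² ≤ B(|t|(M+C))²`
    have hs1 : ∑ b : PBond P j, ‖Y t b‖ ^ 2 ≤ B * (|t| * (M + C)) ^ 2 := by
      calc ∑ b : PBond P j, ‖Y t b‖ ^ 2 ≤ ∑ _b : PBond P j, (|t| * (M + C)) ^ 2 :=
            Finset.sum_le_sum fun b _ => pow_le_pow_left₀ (norm_nonneg _) (hYb t ht b) 2
        _ = B * (|t| * (M + C)) ^ 2 := by rw [Finset.sum_const, Finset.card_univ, nsmul_eq_mul]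
    -- the linearity defect
    have hs2 : ∑ b : PBond P j, ‖Y t b - (t : ℂ) • ξ b‖ ≤ B * (C * t ^ 2) := by
      calc ∑ b : PBond P j, ‖Y t b - (t : ℂ) • ξ b‖ ≤ ∑ _b : PBond P j, C * t ^ 2 :=
            Finset.sum_le_sum fun b _ => hγξ t (ht.trans ht₁₀) b
        _ = B * (C * t ^ 2) := by rw [Finset.sum_const, Finset.card_univ, nsmul_eq_mul]
    have h3 := hΛle (fun b => Y t b - (t : ℂ) • ξ b)
    rw [← hlin t] at h3
    have habs2 := abs_le.mp h2
    have habs3 := abs_le.mp h3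
    have ht2 : (|t| * (M + C)) ^ 2 = (M + C) ^ 2 * t ^ 2 := by rw [mul_pow, sq_abs]; ring
    rw [ht2] at hs1
    have e1 : (8 * 2 + 18) * (4 * (P.d : ℝ)) * ∑ b : PBond P j, ‖Y t b‖ ^ 2 ≤ (8 * 2 + 18) * (4 * D) * (B * ((M + C) ^ 2 * t ^ 2)) :=
      mul_le_mul_of_nonneg_left hs1 (by positivity)
    have e2 : 2 * (4 * D) * ∑ b : PBond P j, ‖Y t b - (t : ℂ) • ξ b‖ ≤ 2 * (4 * D) * (B * (C * t ^ 2)) :=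
      mul_le_mul_of_nonneg_left hs2 (by positivity)
    nlinarith [habs2.1, habs2.2, habs3.1, habs3.2, e1, e2, h0]
  exact eq_zero_of_forall_mul_add_sq_nonneg ht₁pos (by positivity) key

end EulerLagrange


/-! ## §2 Nested criticality at the d = 3 carrier: the k-fold minimiser is a one-step minimiser over its own average -/

section Nested

open T3ContinuumYM3Torus
open T3UnitLawDensityEML (ℰp)
open T3ConstrainedMinimiser (fibre)
open T3TiltDescent (descendTo)
open T3DescentFibreTower (mem_fibre_iff mem_fibre_trans descendTo_mem_fibre)
open T3PrintedRegularMinimiser (RegPr regFibrePr mem_regFibrePr_iff)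
open T3Thm1CarrierNative (IsCritR2)

variable (F : T3Family)

/-- **THE ONE-STEP SLICE LIES IN THE k-FOLD REGULAR FIBRE**: for `n ≤ J ≤ K` and `U` in the `(n,K)`-descent fibre of `V`, every configuration of run `K`
whose `(J,K)`-descent equals that of `U` and which is printed-regular at radius `e` lies in print's regular fibre `(6)(e) = 𝔘_k(e) ∩ 𝔅_k(V)`
(fibres compose along the tower, [Balaban1987RG1] (0.11) `Ū^{k} = M^k(U)`: `T3DescentFibreTower.mem_fibre_trans`). [cite: Balaban1987RG1, (0.11) p.253] -/
theorem oneStepSlice_subset_regFibrePr {n J K : ℕ} (hnJ : n ≤ J) (hJK : J ≤ K) (e : ℝ)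
    {V : GaugeField (F.P n) 0 (Matrix.specialUnitaryGroup (Fin 2) ℂ)} {U : GaugeField (F.P K) 0 (Matrix.specialUnitaryGroup (Fin 2) ℂ)}
    (hU : U ∈ fibre F ℰp n K (hnJ.trans hJK) V) :
    fibre F ℰp J K hJK (descendTo F ℰp J K hJK U) ∩ {W | RegPr F n K e W} ⊆ regFibrePr F n K (hnJ.trans hJK) e V := by
  intro W hW
  rw [mem_regFibrePr_iff]
  exact ⟨mem_fibre_trans F ℰp hnJ hJK hW.1 (descendTo_mem_fibre F ℰp hnJ hJK hU), hW.2⟩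

/-- A printed-regular configuration lies in its own one-step slice. [cite: Balaban1987RG1, (0.11) p.253] -/
theorem mem_oneStepSlice {n J K : ℕ} (hJK : J ≤ K) {e : ℝ} {U : GaugeField (F.P K) 0 (Matrix.specialUnitaryGroup (Fin 2) ℂ)} (hU : RegPr F n K e U) :
    U ∈ fibre F ℰp J K hJK (descendTo F ℰp J K hJK U) ∩ {W | RegPr F n K e W} :=
  ⟨(mem_fibre_iff F ℰp).mpr rfl, hU⟩

/-- **NESTED CRITICALITY**: a minimiser of the Wilson action over print's k-fold regular fibre `(6)(e)` of `V` (comparison height `n`, run `K`) that lies in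
it minimises over the ONE-STEP-TYPE slice `𝔅_{J,K}(D_{J,K}U) ∩ 𝔘_k(e)` through any intermediate height `n ≤ J ≤ K` — in particular (`J = K − 1`) over
the one-step fibre of its own average: every variational (Euler–Lagrange) statement about `U` needs the ONE-STEP (0.4)-average only.  A minimiser over a
set that contains a smaller set through the point minimises over the smaller set. [cite: Balaban1985Variational, (5)-(6) p.278; Balaban1987RG1, (0.11) p.253] -/
theorem isMinOn_oneStepSlice_of_isMinOn {n J K : ℕ} (hnJ : n ≤ J) (hJK : J ≤ K) {e : ℝ}
    {V : GaugeField (F.P n) 0 (Matrix.specialUnitaryGroup (Fin 2) ℂ)} {U : GaugeField (F.P K) 0 (Matrix.specialUnitaryGroup (Fin 2) ℂ)}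
    (hU : U ∈ fibre F ℰp n K (hnJ.trans hJK) V)
    (hmin : IsMinOn (fun W : GaugeField (F.P K) 0 (Matrix.specialUnitaryGroup (Fin 2) ℂ) => wilsonAction4 W) (regFibrePr F n K (hnJ.trans hJK) e V) U) :
    IsMinOn (fun W : GaugeField (F.P K) 0 (Matrix.specialUnitaryGroup (Fin 2) ℂ) => wilsonAction4 W)
      (fibre F ℰp J K hJK (descendTo F ℰp J K hJK U) ∩ {W | RegPr F n K e W}) U :=
  hmin.on_subset (oneStepSlice_subset_regFibrePr F hnJ hJK e hU)

/-- **R2-CRITICALITY IS NESTED**: an R2-critical configuration (`T3Thm1CarrierNative.IsCritR2`: minimiser over `(6)(e)` for some `e > 0`) is, for every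
intermediate height `J`, a minimiser over the one-step-type slice `𝔅_{J,K}(D_{J,K}U) ∩ 𝔘_k(e)` through it, at the same radius.
[cite: Balaban1985Variational, Prop 8 p.304, (6) p.278] -/
theorem isCritR2_oneStepSlice {n J K : ℕ} (hnJ : n ≤ J) (hJK : J ≤ K)
    {V : GaugeField (F.P n) 0 (Matrix.specialUnitaryGroup (Fin 2) ℂ)} {U : GaugeField (F.P K) 0 (Matrix.specialUnitaryGroup (Fin 2) ℂ)}
    (hcrit : IsCritR2 F n K (hnJ.trans hJK) V U) :
    ∃ e : ℝ, 0 < e ∧ RegPr F n K e U ∧ U ∈ fibre F ℰp n K (hnJ.trans hJK) V ∧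
      IsMinOn (fun W : GaugeField (F.P K) 0 (Matrix.specialUnitaryGroup (Fin 2) ℂ) => wilsonAction4 W)
        (fibre F ℰp J K hJK (descendTo F ℰp J K hJK U) ∩ {W | RegPr F n K e W}) U := by
  obtain ⟨e, he, hUe, hmin⟩ := hcrit
  have hU := (mem_regFibrePr_iff F).mp hUe
  exact ⟨e, he, hU.2, hU.1, isMinOn_oneStepSlice_of_isMinOn F hnJ hJK hU.1 hmin⟩

/-- **THE EULER–LAGRANGE EQUATION AT THE CARRIER, ALONG FIBRE CURVES**: if `U₀` is R2-critical over the datum `V` (minimises the Wilson action over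
`(6)(e)` for some `e > 0`) and `γ` is a curve which stays in every regular fibre `(6)(e′) ∋ U₀` for small `|t|` (membership in `𝔅_k(V)` plus continuity at
`U₀`; the regularity clauses (2) are strict, hence open) and whose fluctuation about `U₀` is `tξ + O(t²)` bondwise, then `Lin_{U₀}(ξ) = 0`.
By `isCritR2_oneStepSlice` it suffices that `γ` run inside the ONE-STEP fibre of `D_{K−1,K}U₀`. [cite: Balaban1985Variational, (127) p.297, Prop 8 p.304] -/
theorem lin_eq_zero_of_isCritR2_of_curve {n K : ℕ} (h : n ≤ K)
    {V : GaugeField (F.P n) 0 (Matrix.specialUnitaryGroup (Fin 2) ℂ)} {U₀ : GaugeField (F.P K) 0 (Matrix.specialUnitaryGroup (Fin 2) ℂ)}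
    (hcrit : IsCritR2 F n K h V U₀) (γ : ℝ → GaugeField (F.P K) 0 (Matrix.specialUnitaryGroup (Fin 2) ℂ))
    (hγreg : ∀ e : ℝ, 0 < e → U₀ ∈ regFibrePr F n K h e V → ∃ t₁ : ℝ, 0 < t₁ ∧ ∀ t : ℝ, |t| ≤ t₁ → γ t ∈ regFibrePr F n K h e V)
    (ξ : PBond (F.P K) 0 → Matrix (Fin 2) (Fin 2) ℂ) {t₀ C : ℝ} (ht₀ : 0 < t₀)
    (hγξ : ∀ t : ℝ, |t| ≤ t₀ → ∀ b : PBond (F.P K) 0,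
      ‖(γ t b : Matrix (Fin 2) (Fin 2) ℂ) * star (U₀ b : Matrix (Fin 2) (Fin 2) ℂ) - 1 - (t : ℂ) • ξ b‖ ≤ C * t ^ 2) :
    ∑ p : Plaq (F.P K) 0, (1 / 2) * ((((((GaugeField.plaqHol U₀ p : Matrix.specialUnitaryGroup (Fin 2) ℂ) : Matrix (Fin 2) (Fin 2) ℂ)) - 1)ᴴ
          * ((ξ ⟨p.src, p.μ⟩
              + (U₀ ⟨p.src, p.μ⟩ : Matrix (Fin 2) (Fin 2) ℂ) * ξ ⟨p.src.shift p.μ, p.ν⟩ * star (U₀ ⟨p.src, p.μ⟩ : Matrix (Fin 2) (Fin 2) ℂ)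
              - ((U₀ ⟨p.src, p.μ⟩ * U₀ ⟨p.src.shift p.μ, p.ν⟩ * (U₀ ⟨p.src.shift p.ν, p.μ⟩)⁻¹ : Matrix.specialUnitaryGroup (Fin 2) ℂ) : Matrix (Fin 2) (Fin 2) ℂ)
                  * ξ ⟨p.src.shift p.ν, p.μ⟩
                  * star ((U₀ ⟨p.src, p.μ⟩ * U₀ ⟨p.src.shift p.μ, p.ν⟩ * (U₀ ⟨p.src.shift p.ν, p.μ⟩)⁻¹ : Matrix.specialUnitaryGroup (Fin 2) ℂ) : Matrix (Fin 2) (Fin 2) ℂ)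
              - ((GaugeField.plaqHol U₀ p : Matrix.specialUnitaryGroup (Fin 2) ℂ) : Matrix (Fin 2) (Fin 2) ℂ) * ξ ⟨p.src, p.ν⟩
                  * star ((GaugeField.plaqHol U₀ p : Matrix.specialUnitaryGroup (Fin 2) ℂ) : Matrix (Fin 2) (Fin 2) ℂ))
            * ((GaugeField.plaqHol U₀ p : Matrix.specialUnitaryGroup (Fin 2) ℂ) : Matrix (Fin 2) (Fin 2) ℂ))).trace).re = 0 := by
  obtain ⟨e, he, hUe, hmin⟩ := hcrit
  obtain ⟨t₁, ht₁, hγ₁⟩ := hγreg e he hUe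
  refine lin_eq_zero_of_isMinOn_of_curve hmin γ (lt_min ht₀ ht₁) (fun t ht => hγ₁ t (ht.trans (min_le_right _ _))) ξ
    (fun t ht b => hγξ t (ht.trans (min_le_left _ _)) b)

end Nested

end Summit.QuantumFields.YangMills.Theorems.Prop8Criticality

end
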